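import Literature.AlgebraicGeometry.Motives.QuadricStrataCells
import Literature.AlgebraicGeometry.Motives.SplitQuadricNormalForm
import HarnessLib

/-!
# `CH₁` of a smooth quadric hypersurface is generated by lines (Tian–Zong Thm. 1.7, `c = 1, d = 2`)

The named fact `TianZong2014_chowOne_generatedByLines` (Tian–Zong, *One-cycles on rationally
connected varieties*, Compositio Math. 150 (2014), Thm. 1.7) for **quadric hypersurfaces of any
dimension `n ≥ 2`**: `CH₁` of a smooth quadric `Q ⊆ ℙⁿ⁺¹` over an algebraically closed field of
characteristic zero is generated by the lines of `Q` (`TianZong2014_chowOne_generatedByLines_quadric`).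

Proof (Fulton, *Intersection Theory*, Example 1.9.1, the cellular decomposition of a quadric):
bring `Q` to the split form `x₀x₁ + x₂x₃ + ⋯` (`Motives/SplitQuadricNormalForm`) and run down the
strata `T(s, m) = V₊(x₀, …, x_{s-1}, x_s x_{s+1} + ⋯)` (`Motives/QuadricStrataIdeals`): each has an
affine cell `T(s, m) ∩ D₊(x_s) ≅ 𝔸ᴰ` with `A₁(𝔸ᴰ) = 0` (`Motives/QuadricStrataCells`,
`Motives/AffineSpaceChow`), the localisation sequence moves every `1`-cycle to the complement
(`Motives/CellularPeeling`), which is either one or two linear subspaces (where `CH₁ = ℤ·[line]`,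
`Motives/ChowProjectiveSpaceLines` and `CellularPeeling`) or, after a coordinate permutation
(`Motives/QuadricStrataCells`), the next stratum `T(s+1, m-2)`; induction on `m`
(`linesRep_of_range_eq_stratum`).

Everything is proved; no named facts.

## References

* [TianZong2014] Z. Tian, H. R. Zong, *One-cycles on rationally connected varieties*, Thm. 1.7.
* W. Fulton, *Intersection Theory*, Example 1.9.1. [Fulton1998]
* R. Hartshorne, *Algebraic Geometry*, I Ex. 5.8, II Example 7.1.1. [Hartshorne1977]
-/

noncomputable section

open CategoryTheory AlgebraicGeometry Order TopologicalSpace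

universe u

namespace Literature.AlgebraicGeometry.Motives

namespace ProjectiveSpaceCells

open _root_.MvPolynomial

section LinesRep

variable (k : Type u) [Field k] {N : ℕ}

attribute [local instance] MvPolynomial.gradedAlgebra ProjBaseChange.algebraBase

local notation "𝓐" => MvPolynomial.homogeneousSubmodule (Fin (N + 1)) k

/-- **Line points** of a scheme `Y` mapped to `ℙᴺ` by `e`: points of dimension one whose image
closure is a line `V₊(L₁, …, L_{N-1})` (the rendering `IsLinePoint` of
`Motives/LinesGenerateChowOne`, for a bare morphism of schemes). [folklore] -/
def IsLinePt {Y : Scheme.{u}} (e : Y ⟶ Proj 𝓐) (y : Y) : Prop :=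
  height y = 1 ∧ ∃ L : Fin (N - 1) → MvPolynomial (Fin (N + 1)) k, LinearIndependent k L ∧
    (∀ j, (L j).IsHomogeneous 1) ∧
      ⇑e.base '' closure {y} = ProjectiveSpectrum.zeroLocus 𝓐 (Set.range L)

/-- **Representation of a cycle by lines**: `c` is rationally equivalent to an integral
combination of prime cycles of line points. [folklore] -/
def LinesRep {Y : Scheme.{u}} (e : Y ⟶ Proj 𝓐) (c : AlgebraicCycle Y ℤ) : Prop :=
  ∃ (r : ℕ) (ys : Fin r → Y) (ws : Fin r → ℤ), (∀ i, IsLinePt k e (ys i)) ∧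
    IsRationallyEquivalent c (∑ i, ws i • primeCycle (ys i)) 1

variable {k}

/-- Rational equivalence transports line representations. [folklore] -/
theorem LinesRep.of_isRationallyEquivalent {Y : Scheme.{u}} {e : Y ⟶ Proj 𝓐} {c c' : AlgebraicCycle Y ℤ}
    (h : IsRationallyEquivalent c c' 1) (h' : LinesRep k e c') : LinesRep k e c := by
  obtain ⟨r, ys, ws, hys, hrat⟩ := h'
  exact ⟨r, ys, ws, hys, h.trans hrat⟩

/-- Sums of line representations are line representations. [folklore] -/
theorem LinesRep.add {Y : Scheme.{u}} {e : Y ⟶ Proj 𝓐} {c c' : AlgebraicCycle Y ℤ}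
    (h : LinesRep k e c) (h' : LinesRep k e c') : LinesRep k e (c + c') := by
  obtain ⟨r, ys, ws, hys, hrat⟩ := h
  obtain ⟨r', ys', ws', hys', hrat'⟩ := h'
  refine ⟨r + r', Fin.append ys ys', Fin.append ws ws', fun i ↦ ?_, ?_⟩
  · refine Fin.addCases (fun j ↦ ?_) (fun j ↦ ?_) i
    · simpa using hys j
    · simpa using hys' j
  · have hsum : ∑ i : Fin (r + r'), Fin.append ws ws' i • primeCycle (Fin.append ys ys' i) =
        ∑ i, ws i • primeCycle (ys i) + ∑ i, ws' i • primeCycle (ys' i) := by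
      rw [Fin.sum_univ_add]
      simp
    rw [hsum]
    have h := (ratTrivial Y 1).add_mem hrat hrat'
    change c + c' - _ ∈ ratTrivial Y 1
    convert h using 1
    change _ = (c - _) + (c' - _)
    abel

/-- The zero cycle is represented by no lines. [folklore] -/
theorem LinesRep.zero {Y : Scheme.{u}} (e : Y ⟶ Proj 𝓐) : LinesRep k e 0 :=
  ⟨0, Fin.elim0, Fin.elim0, fun i ↦ i.elim0, by simp [IsRationallyEquivalent.refl]⟩

/-- Finite sums of line representations. [folklore] -/
theorem LinesRep.sum {Y : Scheme.{u}} {e : Y ⟶ Proj 𝓐} {r : ℕ} {cs : Fin r → AlgebraicCycle Y ℤ}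
    (h : ∀ a, LinesRep k e (cs a)) : LinesRep k e (∑ a, cs a) := by
  induction r with
  | zero => simpa using LinesRep.zero e
  | succ r ih =>
    rw [Fin.sum_univ_castSucc]
    exact (ih fun a ↦ h _).add (h _)

/-- A single line point. [folklore] -/
theorem LinesRep.single {Y : Scheme.{u}} {e : Y ⟶ Proj 𝓐} {c : AlgebraicCycle Y ℤ} {y : Y} {a : ℤ}
    (hy : IsLinePt k e y) (h : IsRationallyEquivalent c (a • primeCycle y) 1) : LinesRep k e c :=
  ⟨1, fun _ ↦ y, fun _ ↦ a, fun _ ↦ hy, by simpa using h⟩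

/-! ### Transport of line points -/

/-- **Line points pull back along a projective linear transformation**: if `e ≫ σ_τ` sends `y` to a
line then so does `e` (the preimage of a line under `σ_τ` is the line cut out by the substituted
forms). [cite: Hartshorne1977, II Example 7.1.1] -/
theorem IsLinePt.of_comp_substMapHom {Y : Scheme.{u}} (e : Y ⟶ Proj 𝓐)
    (τ : Fin (N + 1) → MvPolynomial (Fin (N + 1)) k) (hτ : ∀ j, (τ j).IsHomogeneous 1)
    (τ' : Fin (N + 1) → MvPolynomial (Fin (N + 1)) k) (hτ' : ∀ j, (τ' j).IsHomogeneous 1)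
    (hinv : ∀ p, MvPolynomial.aeval τ (MvPolynomial.aeval τ' p) = p)
    (hinv' : ∀ p, MvPolynomial.aeval τ' (MvPolynomial.aeval τ p) = p) {y : Y}
    (h : IsLinePt k (e ≫ ProjectiveSpace.substMapHom τ hτ τ' hτ' hinv) y) : IsLinePt k e y := by
  obtain ⟨hh, L, hL, hhom, himg⟩ := h
  haveI : IsIso (ProjectiveSpace.substMapHom τ hτ τ' hτ' hinv) := isIso_substMapHom τ hτ τ' hτ' hinv hinv'
  refine ⟨hh, fun j ↦ MvPolynomial.aeval τ (L j), ?_, fun j ↦ (hhom j).aeval τ hτ, ?_⟩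
  · refine hL.map' (MvPolynomial.aeval τ).toLinearMap ?_
    rw [LinearMap.ker_eq_bot]
    intro p q hpq
    have h := congrArg (MvPolynomial.aeval τ') hpq
    change MvPolynomial.aeval τ' (MvPolynomial.aeval τ p) = MvPolynomial.aeval τ' (MvPolynomial.aeval τ q) at h
    rwa [hinv', hinv'] at h
  · have h1 : ⇑e.base '' closure {y} = (ProjectiveSpace.substMapHom τ hτ τ' hτ' hinv).base ⁻¹'
        ((e ≫ ProjectiveSpace.substMapHom τ hτ τ' hτ' hinv).base '' closure {y}) := by
      rw [Scheme.Hom.comp_base, TopCat.coe_comp, Set.image_comp]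
      exact (Set.preimage_image_eq _
        (ProjectiveSpace.substMapHom τ hτ τ' hτ' hinv).isClosedEmbedding.injective).symm
    rw [h1, himg, substMapHom_preimage_zeroLocus, ← Set.range_comp]
    rfl

/-- **Line points push forward along a closed immersion.** [folklore] -/
theorem IsLinePt.base_of_isClosedImmersion {W Y : Scheme.{u}} (ι : W ⟶ Y) [IsClosedImmersion ι]
    (e : Y ⟶ Proj 𝓐) {y : W} (h : IsLinePt k (ι ≫ e) y) : IsLinePt k e (ι.base y) := by
  obtain ⟨hh, L, hL, hhom, himg⟩ := h
  refine ⟨by rw [height_base_eq_of_isClosedImmersion' ι y]; exact hh, L, hL, hhom, ?_⟩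
  have h1 : ⇑e.base '' closure {ι.base y} = ⇑(ι ≫ e).base '' closure {y} := by
    rw [← Set.image_singleton, ι.isClosedEmbedding.closure_image_eq, ← Set.image_comp]
    rfl
  rw [h1]
  exact himg

/-- Line representations pull back along a projective linear transformation. [folklore] -/
theorem LinesRep.of_comp_substMapHom {Y : Scheme.{u}} (e : Y ⟶ Proj 𝓐)
    (τ : Fin (N + 1) → MvPolynomial (Fin (N + 1)) k) (hτ : ∀ j, (τ j).IsHomogeneous 1)
    (τ' : Fin (N + 1) → MvPolynomial (Fin (N + 1)) k) (hτ' : ∀ j, (τ' j).IsHomogeneous 1)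
    (hinv : ∀ p, MvPolynomial.aeval τ (MvPolynomial.aeval τ' p) = p)
    (hinv' : ∀ p, MvPolynomial.aeval τ' (MvPolynomial.aeval τ p) = p) {c : AlgebraicCycle Y ℤ}
    (h : LinesRep k (e ≫ ProjectiveSpace.substMapHom τ hτ τ' hτ' hinv) c) : LinesRep k e c := by
  obtain ⟨r, ys, ws, hys, hrat⟩ := h
  exact ⟨r, ys, ws, fun i ↦ (hys i).of_comp_substMapHom e τ hτ τ' hτ' hinv hinv', hrat⟩

/-- **Line representations push forward along a closed immersion over `k`** (Fulton Thm. 1.4).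
[cite: Fulton1998, Thm. 1.4] -/
theorem LinesRep.map_of_isClosedImmersion {W Y : Scheme.{u}} (ι : W ⟶ Y) [IsClosedImmersion ι]
    (e : Y ⟶ Proj 𝓐) (f : Y ⟶ Spec (CommRingCat.of k)) [LocallyOfFiniteType f]
    {c : AlgebraicCycle W ℤ} (h : LinesRep k (ι ≫ e) c) :
    LinesRep k e (AlgebraicCycle.map ι height height c) := by
  obtain ⟨r, ys, ws, hys, hrat⟩ := h
  refine ⟨r, fun i ↦ ι.base (ys i), ws, fun i ↦ (hys i).base_of_isClosedImmersion ι e, ?_⟩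
  have h := IsRationallyEquivalent.map_of_isClosedImmersion ι f hrat
  have hsum : AlgebraicCycle.map ι height height (∑ i, ws i • primeCycle (ys i)) =
      ∑ i, ws i • primeCycle (ι.base (ys i)) := by
    change mapAddHom ι _ = _
    rw [map_sum]
    refine Finset.sum_congr rfl fun i _ ↦ ?_
    rw [map_zsmul, mapAddHom_apply, algebraicCycleMap_primeCycle]
  rwa [hsum] at h

/-- **Linear ranges**: `CH₁` of a linear subspace gives a line representation
(`Motives/CellularPeeling`). [cite: Fulton1998, Example 1.9.3] -/
theorem linesRep_of_range_eq_zeroLocus_linear {t : ℕ} (htN : t < N)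
    (L : Fin t → MvPolynomial (Fin (N + 1)) k) (hli : LinearIndependent k L)
    (hL : ∀ a, (L a).IsHomogeneous 1) {Y : Scheme.{u}} [IsIntegral Y] (e : Y ⟶ Proj 𝓐)
    [IsClosedImmersion e] (hrange : Set.range e.base = ProjectiveSpectrum.zeroLocus 𝓐 (Set.range L))
    (c : AlgebraicCycle Y ℤ) (hc : c ∈ cyclesOfDim Y 1) : LinesRep k e c := by
  obtain ⟨y, a, L', hL', hhom', himg, hh, hrat⟩ :=
    exists_isRationallyEquivalent_zsmul_of_range_eq_zeroLocus_linear htN L hli hL e hrange c hc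
  exact LinesRep.single ⟨hh, L', hL', hhom', himg⟩ hrat

end LinesRep


/-! ### The linear pieces `V₊(x₀, …, x_s, x_e)` of the complements -/

section Pieces

variable (k : Type u) [Field k] {N : ℕ}

attribute [local instance] MvPolynomial.gradedAlgebra ProjBaseChange.algebraBase

local notation "𝓐" => MvPolynomial.homogeneousSubmodule (Fin (N + 1)) k

/-- The `s + 2` linear forms `x₀, …, x_s, x_e`. [folklore] -/
def pieceForms (s e : ℕ) (hse : s < e) (he : e ≤ N) : Fin (s + 2) → MvPolynomial (Fin (N + 1)) k :=
  fun i ↦ MvPolynomial.X ⟨if (i : ℕ) ≤ s then (i : ℕ) else e, by split_ifs <;> omega⟩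

variable {k}

/-- Auxiliary computation (`isHomogeneous_pieceForms`). [folklore] -/
theorem isHomogeneous_pieceForms (s e : ℕ) (hse : s < e) (he : e ≤ N) (i : Fin (s + 2)) :
    (pieceForms k s e hse he i).IsHomogeneous 1 :=
  MvPolynomial.isHomogeneous_X k _

/-- Auxiliary computation (`linearIndependent_pieceForms`). [folklore] -/
theorem linearIndependent_pieceForms (s e : ℕ) (hse : s < e) (he : e ≤ N) :
    LinearIndependent k (pieceForms k s e hse he) := by
  refine (MvPolynomial.linearIndependent_X (Fin (N + 1)) k).comp
    (fun i : Fin (s + 2) ↦ (⟨if (i : ℕ) ≤ s then (i : ℕ) else e, by split_ifs <;> omega⟩ : Fin (N + 1)))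
    fun a b hab ↦ ?_
  have h := congrArg Fin.val hab
  simp only at h
  refine Fin.ext ?_
  split_ifs at h <;> omega

/-- `{x₀, …, x_s, x_e}` as the image of the index set. [folklore] -/
theorem range_pieceForms (s e : ℕ) (hse : s < e) (he : e ≤ N) :
    Set.range (pieceForms k s e hse he) =
      (fun j ↦ (MvPolynomial.X j : MvPolynomial (Fin (N + 1)) k)) ''
        ({j : Fin (N + 1) | (j : ℕ) ≤ s} ∪ {⟨e, by omega⟩}) := by
  ext f
  simp only [Set.mem_range, pieceForms, Set.mem_image, Set.mem_union, Set.mem_setOf_eq,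
    Set.mem_singleton_iff]
  constructor
  · rintro ⟨i, rfl⟩
    refine ⟨_, ?_, rfl⟩
    by_cases hi : (i : ℕ) ≤ s
    · left; simp [hi]
    · right; exact Fin.ext (by simp [hi])
  · rintro ⟨j, hj | hj, rfl⟩
    · refine ⟨⟨j, by omega⟩, ?_⟩
      congr 1; exact Fin.ext (by simp [hj])
    · subst hj
      refine ⟨⟨s + 1, by omega⟩, ?_⟩
      congr 1; exact Fin.ext (by simp)

/-- A point whose ideal contains `x₀, …, x_s, x_e` lies on `V₊(pieceForms)`. [folklore] -/
theorem mem_zeroLocus_pieceForms {s e : ℕ} (hse : s < e) (he : e ≤ N) {z : ↥(Proj 𝓐)}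
    (hle : ∀ j : Fin (N + 1), (j : ℕ) ≤ s →
      (MvPolynomial.X j : MvPolynomial (Fin (N + 1)) k) ∈ (z : ProjectiveSpectrum 𝓐).asHomogeneousIdeal)
    (hxe : (MvPolynomial.X ⟨e, by omega⟩ : MvPolynomial (Fin (N + 1)) k) ∈
      (z : ProjectiveSpectrum 𝓐).asHomogeneousIdeal) :
    z ∈ ProjectiveSpectrum.zeroLocus 𝓐 (Set.range (pieceForms k s e hse he)) := by
  change Set.range (pieceForms k s e hse he) ⊆ ((z : ProjectiveSpectrum 𝓐).asHomogeneousIdeal : Set (MvPolynomial (Fin (N + 1)) k))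
  rintro f ⟨i, rfl⟩
  simp only [pieceForms, SetLike.mem_coe]
  by_cases hi : (i : ℕ) ≤ s
  · have : (⟨if (i : ℕ) ≤ s then (i : ℕ) else e, by rw [if_pos hi]; omega⟩ : Fin (N + 1)) = ⟨i, by omega⟩ :=
      Fin.ext (by simp [hi])
    rw [this]; exact hle _ (by simpa using hi)
  · have : (⟨if (i : ℕ) ≤ s then (i : ℕ) else e, by rw [if_neg hi]; omega⟩ : Fin (N + 1)) = ⟨e, by omega⟩ :=
      Fin.ext (by simp [hi])
    rw [this]; exact hxe

/-- Points of `V₊(x₀, …, x_s, x_e)` contain the variables `x_j (j ≤ s)` and `x_e`. [folklore] -/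
theorem X_mem_of_mem_zeroLocus_pieceForms {s e : ℕ} (hse : s < e) (he : e ≤ N) {z : ↥(Proj 𝓐)}
    (hz : z ∈ ProjectiveSpectrum.zeroLocus 𝓐 (Set.range (pieceForms k s e hse he))) :
    (∀ j : Fin (N + 1), (j : ℕ) ≤ s →
      (MvPolynomial.X j : MvPolynomial (Fin (N + 1)) k) ∈ (z : ProjectiveSpectrum 𝓐).asHomogeneousIdeal) ∧
    (MvPolynomial.X ⟨e, by omega⟩ : MvPolynomial (Fin (N + 1)) k) ∈
      (z : ProjectiveSpectrum 𝓐).asHomogeneousIdeal := by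
  set P : ProjectiveSpectrum 𝓐 := z
  change Set.range _ ⊆ (P.asHomogeneousIdeal : Set (MvPolynomial (Fin (N + 1)) k)) at hz
  refine ⟨fun j hj ↦ ?_, ?_⟩
  · have h := hz ⟨⟨j, by omega⟩, rfl⟩
    simp only [pieceForms, SetLike.mem_coe] at h
    convert h using 2
    exact Fin.ext (by simp [hj])
  · have h := hz ⟨⟨s + 1, by omega⟩, rfl⟩
    simp only [pieceForms, SetLike.mem_coe] at h
    convert h using 2
    exact Fin.ext (by simp)

/-- **The piece `V₊(x₀, …, x_s, x_{s+2})` lies on `T(s, 3)`.** [folklore] -/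
theorem zeroLocus_pieceForms_subset_stratum_one {s : ℕ} (hsm : s + 2 + 1 ≤ N + 1) :
    ProjectiveSpectrum.zeroLocus 𝓐 (Set.range (pieceForms k s (s + 2) (by omega) (by omega))) ⊆
      stratum (k := k) s (1 + 2) (by omega) := by
  intro z hz
  obtain ⟨hX, hXe⟩ := X_mem_of_mem_zeroLocus_pieceForms (by omega) (by omega) hz
  set P : ProjectiveSpectrum 𝓐 := z
  change coneGens (k := k) s (1 + 2) _ ⊆ (P.asHomogeneousIdeal : Set (MvPolynomial (Fin (N + 1)) k))
  rintro g (⟨j, hj, rfl⟩ | hg)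
  · exact hX j (by simp only [Set.mem_setOf_eq] at hj; omega)
  · rw [Set.mem_singleton_iff] at hg
    subst hg
    rw [SetLike.mem_coe, splitFormAt_add_two, splitFormAt_one]
    exact Ideal.add_mem _ (Ideal.mul_mem_right _ _ (hX ⟨s, by omega⟩ le_rfl))
      (Ideal.mul_mem_right _ _ hXe)

/-- **The pieces `V₊(x₀, …, x_s, x_e)`, `e ∈ {s+2, s+3}`, lie on `T(s, 4)`.** [folklore] -/
theorem zeroLocus_pieceForms_subset_stratum_two {s e : ℕ} (he : e = s + 2 ∨ e = s + 3)
    (hsm : s + 2 + 2 ≤ N + 1) :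
    ProjectiveSpectrum.zeroLocus 𝓐 (Set.range (pieceForms k s e (by omega) (by omega))) ⊆
      stratum (k := k) s (2 + 2) (by omega) := by
  intro z hz
  obtain ⟨hX, hXe⟩ := X_mem_of_mem_zeroLocus_pieceForms (by omega) (by omega) hz
  set P : ProjectiveSpectrum 𝓐 := z
  change coneGens (k := k) s (2 + 2) _ ⊆ (P.asHomogeneousIdeal : Set (MvPolynomial (Fin (N + 1)) k))
  rintro g (⟨j, hj, rfl⟩ | hg)
  · exact hX j (by simp only [Set.mem_setOf_eq] at hj; omega)
  · rw [Set.mem_singleton_iff] at hg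
    subst hg
    rw [SetLike.mem_coe, splitFormAt_add_two, splitFormAt_add_two, splitFormAt_zero, add_zero]
    refine Ideal.add_mem _ (Ideal.mul_mem_right _ _ (hX ⟨s, by omega⟩ le_rfl)) ?_
    rcases he with rfl | rfl
    · exact Ideal.mul_mem_right _ _ hXe
    · exact Ideal.mul_mem_left _ _ hXe

/-- **The complement for `m = 1` is the linear piece `V₊(x₀, …, x_s, x_{s+2})`** (`x_{s+2}² ∈ 𝔭`
gives `x_{s+2} ∈ 𝔭`). [folklore] -/
theorem coneSet_one_subset (s : ℕ) (hsm : s + 2 + 1 ≤ N + 1) :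
    coneSet k s 1 hsm ⊆ ProjectiveSpectrum.zeroLocus 𝓐 (Set.range (pieceForms k s (s + 2) (by omega) (by omega))) := by
  intro z hz
  set P : ProjectiveSpectrum 𝓐 := z
  change _ ⊆ (P.asHomogeneousIdeal : Set (MvPolynomial (Fin (N + 1)) k)) at hz
  refine mem_zeroLocus_pieceForms (by omega) (by omega) (fun j hj ↦ hz (Or.inl ⟨j, hj, rfl⟩)) ?_
  have h : splitFormAt k (s + 2) 1 hsm ∈ P.asHomogeneousIdeal := hz (Or.inr rfl)
  rw [splitFormAt_one] at h
  exact (P.isPrime.mem_or_mem h).elim id id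

/-- **The complement for `m = 2` is the union of the two linear pieces** `V₊(x₀, …, x_s, x_{s+2})`,
`V₊(x₀, …, x_s, x_{s+3})`. [folklore] -/
theorem coneSet_two_subset (s : ℕ) (hsm : s + 2 + 2 ≤ N + 1) {z : ↥(Proj 𝓐)} (hz : z ∈ coneSet k s 2 hsm) :
    z ∈ ProjectiveSpectrum.zeroLocus 𝓐 (Set.range (pieceForms k s (s + 2) (by omega) (by omega))) ∨
      z ∈ ProjectiveSpectrum.zeroLocus 𝓐 (Set.range (pieceForms k s (s + 3) (by omega) (by omega))) := by
  set P : ProjectiveSpectrum 𝓐 := z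
  change _ ⊆ (P.asHomogeneousIdeal : Set (MvPolynomial (Fin (N + 1)) k)) at hz
  have hX : ∀ j : Fin (N + 1), (j : ℕ) ≤ s → (MvPolynomial.X j : MvPolynomial (Fin (N + 1)) k) ∈
      P.asHomogeneousIdeal := fun j hj ↦ hz (Or.inl ⟨j, hj, rfl⟩)
  have h : splitFormAt k (s + 2) 2 hsm ∈ P.asHomogeneousIdeal := hz (Or.inr rfl)
  rw [splitFormAt_add_two, splitFormAt_zero, add_zero] at h
  rcases P.isPrime.mem_or_mem h with h1 | h2
  · exact Or.inl (mem_zeroLocus_pieceForms (by omega) (by omega) hX h1)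
  · exact Or.inr (mem_zeroLocus_pieceForms (by omega) (by omega) hX h2)

/-- The cone is contained in the stratum: `C(s, m) ⊆ T(s, m+2)`. [folklore] -/
theorem coneSet_subset_stratum (s m : ℕ) (hsm : s + 2 + m ≤ N + 1) :
    coneSet k s m hsm ⊆ stratum (k := k) s (m + 2) (by omega) := by
  intro z hz
  set P : ProjectiveSpectrum 𝓐 := z
  change _ ⊆ (P.asHomogeneousIdeal : Set (MvPolynomial (Fin (N + 1)) k)) at hz
  change coneGens (k := k) s (m + 2) _ ⊆ (P.asHomogeneousIdeal : Set (MvPolynomial (Fin (N + 1)) k))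
  rintro g (⟨j, hj, rfl⟩ | hg)
  · exact hz (Or.inl ⟨j, by simp only [Set.mem_setOf_eq] at hj ⊢; omega, rfl⟩)
  · rw [Set.mem_singleton_iff] at hg
    subst hg
    rw [SetLike.mem_coe, splitFormAt_add_two]
    exact Ideal.add_mem _ (Ideal.mul_mem_right _ _ (hz (Or.inl ⟨⟨s, by omega⟩, by simp, rfl⟩)))
      (hz (Or.inr rfl))

end Pieces

/-! ### The induction down the strata -/

section Induction

variable (k : Type u) [Field k] {N : ℕ}

attribute [local instance] MvPolynomial.gradedAlgebra ProjBaseChange.algebraBase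

local notation "𝓐" => MvPolynomial.homogeneousSubmodule (Fin (N + 1)) k

variable {k}

/-- For a closed immersion `e`, `e z ∈ closure {e y} → z ∈ closure {y}`. [folklore] -/
theorem mem_closure_of_base_mem {Y : Scheme.{u}} (e : Y ⟶ Proj 𝓐) [IsClosedImmersion e] {z y : Y}
    (h : e.base z ∈ closure {e.base y}) : z ∈ closure {y} := by
  rw [← Set.image_singleton, e.isClosedEmbedding.closure_image_eq] at h
  obtain ⟨z', hz', hzz'⟩ := h
  rwa [← e.isClosedEmbedding.injective hzz']

/-- **A linear piece**: if `y₁ ∈ Y` maps to the generic point of a linear subspace cut out by `t < N`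
independent forms, the push-forward of every `1`-cycle of `closure {y₁}` has a line representation.
[cite: Fulton1998, Example 1.9.3] -/
theorem linesRep_map_ofPoint_linear {Y : Scheme.{u}} (e : Y ⟶ Proj 𝓐) [IsClosedImmersion e]
    (f : Y ⟶ Spec (CommRingCat.of k)) [LocallyOfFiniteType f]
    {t : ℕ} (htN : t < N) (L : Fin t → MvPolynomial (Fin (N + 1)) k) (hL : LinearIndependent k L)
    (hhom : ∀ j, (L j).IsHomogeneous 1) {y₁ : Y}
    (hy₁ : e.base y₁ = linearSubspacePoint L hL hhom htN.le)
    (c : AlgebraicCycle (ClosedSubvariety.ofPoint Y y₁).carrier ℤ)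
    (hc : c ∈ cyclesOfDim (ClosedSubvariety.ofPoint Y y₁).carrier 1) :
    LinesRep k e (AlgebraicCycle.map (ClosedSubvariety.ofPoint Y y₁).ι height height c) := by
  let W := ClosedSubvariety.ofPoint Y y₁
  haveI : IsIntegral W.carrier := W.isIntegral
  have hrange : Set.range (W.ι ≫ e).base = ProjectiveSpectrum.zeroLocus 𝓐 (Set.range L) := by
    rw [Scheme.Hom.comp_base, TopCat.coe_comp, Set.range_comp, ClosedSubvariety.range_ofPoint_ι,
      ← e.isClosedEmbedding.closure_image_eq, Set.image_singleton, hy₁]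
    exact closure_linearSubspacePoint L hL hhom htN.le
  exact (linesRep_of_range_eq_zeroLocus_linear htN L hL hhom (W.ι ≫ e) hrange c hc).map_of_isClosedImmersion
    W.ι e f

/-- `LinesRep` through the shift automorphism. [folklore] -/
theorem LinesRep.of_comp_shiftMap {Y : Scheme.{u}} (e : Y ⟶ Proj 𝓐) (a b : ℕ) (hab : a ≤ b)
    (hb : b < N + 1) {c : AlgebraicCycle Y ℤ} (h : LinesRep k (e ≫ shiftMap k a b hab hb) c) :
    LinesRep k e c :=
  LinesRep.of_comp_substMapHom e _ _ _ _ _ (shiftSubst_inv' k a b hab hb) h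

/-- **Peeling with a piece handler**: if `A₁(U) = 0`, the complement of `U` is covered by the
closures of `y₁, …, y_r`, and push-forwards of `1`-cycles from each `closure {yₐ}` have line
representations, then every `1`-cycle on `Y` has one. [cite: Fulton1998, Example 1.9.1] -/
theorem linesRep_of_pieces {Y : Scheme.{u}} [IsIntegral Y] [CompactSpace ↥Y] (e : Y ⟶ Proj 𝓐)
    (f : Y ⟶ Spec (CommRingCat.of k)) [LocallyOfFiniteType f] [QuasiCompact f]
    (U : Y.Opens) (hU : cyclesOfDim (U : Scheme.{u}) 1 ≤ ratTrivial (U : Scheme.{u}) 1)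
    {r : ℕ} (y : Fin r → Y) (hcover : ∀ z : Y, z ∉ U → ∃ a, z ∈ closure {y a})
    (hpiece : ∀ (a : Fin r) (cs : AlgebraicCycle (ClosedSubvariety.ofPoint Y (y a)).carrier ℤ),
      cs ∈ cyclesOfDim (ClosedSubvariety.ofPoint Y (y a)).carrier 1 →
        LinesRep k e (AlgebraicCycle.map (ClosedSubvariety.ofPoint Y (y a)).ι height height cs))
    (c : AlgebraicCycle Y ℤ) (hc : c ∈ cyclesOfDim Y 1) : LinesRep k e c := by
  obtain ⟨cs, hcs, hrat⟩ := exists_isRationallyEquivalent_sum_map_of_cell f U hU y hcover c hc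
  exact LinesRep.of_isRationallyEquivalent hrat (LinesRep.sum fun a ↦ hpiece a (cs a) (hcs a))

/-- **`CH₁` along the strata of the split quadric** (Fulton Example 1.9.1): for `m ≥ 1`, an
integral compact `Y` and a closed immersion `e : Y ↪ ℙᴺ_k` with image the stratum `T(s, m+2)`,
provided the cells stay of dimension `≥ 2` down the recursion (`N - s - 1 ≥ 2 + ⌊(m-1)/2⌋`), every
`1`-cycle on `Y` is rationally equivalent on `Y` to an integral combination of prime cycles of line
points. Induction on `m`: peel the cell `D₊(x_s) ≅ 𝔸ᴰ`
(`A₁ = 0`), decompose what is left along the complement — one linear piece (`m = 1`), two linear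
pieces (`m = 2`), or the cone `C(s, m)` (`m ≥ 3`), which the shift automorphism identifies with
`T(s+1, m)` — and push the representations forward. [cite: Fulton1998, Example 1.9.1] -/
theorem linesRep_of_range_eq_stratum :
    ∀ (m : ℕ), 1 ≤ m → ∀ (s : ℕ) (hsm : s + 2 + m ≤ N + 1) (hDm : s + 3 + (m - 1) / 2 ≤ N)
      {Y : Scheme.{u}} [IsIntegral Y] [CompactSpace ↥Y] (e : Y ⟶ Proj 𝓐) [IsClosedImmersion e],
      Set.range e.base = stratum (k := k) s (m + 2) (by omega) →
      ∀ c ∈ cyclesOfDim Y 1, LinesRep k e c := by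
  intro m
  induction m using Nat.strong_induction_on with
  | _ m ih =>
  intro hm s hsm hDm Y _ _ e _ hrange c hc
  classical
  -- numerology: the cell has dimension `D = N - s - 1 ≥ 2`
  obtain ⟨D, hD⟩ : ∃ D, s + 1 + D = N := ⟨N - s - 1, by omega⟩
  have hmD : m ≤ D := by omega
  have hD2 : 2 ≤ D := by omega
  have htN : s + 2 < N := by omega
  -- `Y` over `k`
  haveI : IsProper (projectiveSpace N k).hom := isProper_projectiveSpace N k
  let e' : Y ⟶ (projectiveSpace N k).left := e
  haveI : IsClosedImmersion e' := ‹IsClosedImmersion e›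
  let f : Y ⟶ Spec (CommRingCat.of k) := e' ≫ (projectiveSpace N k).hom
  haveI hf₁ : LocallyOfFiniteType f := inferInstance
  haveI hf₂ : QuasiCompact f := inferInstance
  -- the cell and its complement
  let U : Y.Opens := e ⁻¹ᵁ Proj.basicOpen 𝓐 (MvPolynomial.X (cs s D hD))
  have hU : cyclesOfDim (U : Scheme.{u}) 1 ≤ ratTrivial (U : Scheme.{u}) 1 :=
    cyclesOfDim_one_preimage_basicOpen_stratum_le k s m D hD hmD hD2 e hrange
  have hcompl : ∀ z : Y, z ∉ U → e.base z ∈ coneSet k s m hsm := fun z hz ↦ by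
    have hzT : e.base z ∈ stratum (k := k) s (m + 2) (by omega) := hrange ▸ ⟨z, rfl⟩
    exact mem_coneSet_of_notMem_basicOpen k s m hsm hzT hz
  have hmem : ∀ P : ↥(Proj 𝓐), P ∈ stratum (k := k) s (m + 2) (by omega) → ∃ y : Y, e.base y = P :=
    fun P hP ↦ by rw [← hrange] at hP; exact hP
  -- linear pieces: the point of `Y` over the generic point of `V₊(x₀, …, x_s, x_e)` and the handler
  have hlin : ∀ (e₀ : ℕ) (he₁ : s + 2 ≤ e₀) (he₂ : e₀ ≤ s + 3) (he₃ : e₀ ≤ N)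
      (hsub : ProjectiveSpectrum.zeroLocus 𝓐 (Set.range (pieceForms k (N := N) s e₀ (by omega) he₃)) ⊆
        stratum (k := k) s (m + 2) (by omega)),
      ∃ y₁ : Y, (∀ z : Y, e.base z ∈ ProjectiveSpectrum.zeroLocus 𝓐
          (Set.range (pieceForms k (N := N) s e₀ (by omega) he₃)) → z ∈ closure {y₁}) ∧
        ∀ (cs : AlgebraicCycle (ClosedSubvariety.ofPoint Y y₁).carrier ℤ),
          cs ∈ cyclesOfDim (ClosedSubvariety.ofPoint Y y₁).carrier 1 →
            LinesRep k e (AlgebraicCycle.map (ClosedSubvariety.ofPoint Y y₁).ι height height cs) := by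
    intro e₀ he₁ he₂ he₃ hsub
    have hL := linearIndependent_pieceForms (k := k) (N := N) s e₀ (by omega) he₃
    have hhom := isHomogeneous_pieceForms (k := k) (N := N) s e₀ (by omega) he₃
    obtain ⟨y₁, hy₁⟩ : ∃ y : Y, e.base y =
        linearSubspacePoint (pieceForms k (N := N) s e₀ (by omega) he₃) hL hhom htN.le :=
      hmem _ (hsub (linearSubspacePoint_mem_zeroLocus _ hL hhom htN.le))
    have hcl : closure ({linearSubspacePoint (pieceForms k (N := N) s e₀ (by omega) he₃) hL hhom
        htN.le} : Set ↥(Proj 𝓐)) = ProjectiveSpectrum.zeroLocus 𝓐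
          (Set.range (pieceForms k (N := N) s e₀ (by omega) he₃)) :=
      closure_linearSubspacePoint _ hL hhom htN.le
    refine ⟨y₁, fun z hz ↦ mem_closure_of_base_mem e ?_, fun cs hcs ↦ ?_⟩
    · rw [hy₁]
      exact ((Set.ext_iff.mp hcl) (e.base z)).mpr hz
    · exact linesRep_map_ofPoint_linear e f htN _ hL hhom hy₁ cs hcs
  rcases (show m = 1 ∨ m = 2 ∨ 3 ≤ m by omega) with hm1 | hm2 | hm3
  · -- one linear piece `V₊(x₀, …, x_s, x_{s+2})`
    subst hm1
    obtain ⟨y₁, hcl, hpiece⟩ := hlin (s + 2) le_rfl (by omega) (by omega)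
      (zeroLocus_pieceForms_subset_stratum_one hsm)
    refine linesRep_of_pieces e f U hU (fun _ : Fin 1 ↦ y₁) (fun z hz ↦ ⟨0, hcl z ?_⟩)
      (fun _ cs hcs ↦ hpiece cs hcs) c hc
    exact coneSet_one_subset s hsm (hcompl z hz)
  · -- two linear pieces
    subst hm2
    obtain ⟨y₁, hcl₁, hpiece₁⟩ := hlin (s + 2) le_rfl (by omega) (by omega)
      (zeroLocus_pieceForms_subset_stratum_two (Or.inl rfl) hsm)
    obtain ⟨y₂, hcl₂, hpiece₂⟩ := hlin (s + 3) (by omega) le_rfl (by omega)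
      (zeroLocus_pieceForms_subset_stratum_two (Or.inr rfl) hsm)
    refine linesRep_of_pieces e f U hU ![y₁, y₂] (fun z hz ↦ ?_) (fun a cs hcs ↦ ?_) c hc
    · rcases coneSet_two_subset s hsm (hcompl z hz) with h | h
      · exact ⟨0, hcl₁ z h⟩
      · exact ⟨1, hcl₂ z h⟩
    · revert cs
      refine Fin.cases ?_ (fun i ↦ ?_) a
      · exact fun cs hcs ↦ hpiece₁ cs hcs
      · intro cs hcs
        have hi : i = 0 := Fin.ext (by omega)
        subst hi
        exact hpiece₂ cs hcs
  · -- the cone `C(s, m)`, renormalised to `T(s+1, m)`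
    obtain ⟨m', rfl⟩ : ∃ m', m = m' + 2 := ⟨m - 2, by omega⟩
    obtain ⟨yC, hyC⟩ : ∃ y : Y, e.base y = conePoint k s (m' + 2) hsm hm3 :=
      hmem _ (coneSet_subset_stratum s (m' + 2) hsm (conePoint_mem k s (m' + 2) hsm hm3))
    refine linesRep_of_pieces e f U hU (fun _ : Fin 1 ↦ yC) (fun z hz ↦ ⟨0, ?_⟩)
      (fun _ cs hcs ↦ ?_) c hc
    · refine mem_closure_of_base_mem e ?_
      rw [hyC, closure_conePoint]
      exact hcompl z hz
    · -- the piece `W = closure {yC}`, embedded onto `C(s, m)` and then shifted onto `T(s+1, m)`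
      haveI : IsIntegral (ClosedSubvariety.ofPoint Y yC).carrier := (ClosedSubvariety.ofPoint Y yC).isIntegral
      haveI : CompactSpace ↥(ClosedSubvariety.ofPoint Y yC).carrier :=
        (ClosedSubvariety.ofPoint Y yC).ι.isClosedEmbedding.compactSpace
      have hrange₀ : Set.range ((ClosedSubvariety.ofPoint Y yC).ι ≫ e).base = coneSet k s (m' + 2) hsm := by
        rw [Scheme.Hom.comp_base, TopCat.coe_comp, Set.range_comp, ClosedSubvariety.range_ofPoint_ι,
          ← e.isClosedEmbedding.closure_image_eq, Set.image_singleton, hyC, closure_conePoint]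
      have hrange₁ : Set.range (((ClosedSubvariety.ofPoint Y yC).ι ≫ e) ≫
          shiftMap k (s + 1) (s + 1 + (m' + 2)) (by omega) (by omega)).base =
            stratum (k := k) (s + 1) (m' + 2) (by omega) := by
        rw [Scheme.Hom.comp_base, TopCat.coe_comp, Set.range_comp, hrange₀,
          ← shiftMap_preimage_stratum k s (m' + 2) hsm]
        exact Set.image_preimage_eq _
          (shiftMap k (s + 1) (s + 1 + (m' + 2)) (by omega) (by omega)).homeomorph.surjective
      have h₁ := ih m' (by omega) (by omega) (s + 1) (by omega) (by omega) _ hrange₁ cs hcs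
      exact (LinesRep.of_comp_shiftMap _ _ _ _ _ h₁).map_of_isClosedImmersion _ e f

end Induction

end ProjectiveSpaceCells

/-! ### Tian–Zong Thm. 1.7 for quadric hypersurfaces -/

section Fact

attribute [local instance] MvPolynomial.gradedAlgebra ProjBaseChange.algebraBase

/-- **`CH₁` of a smooth quadric hypersurface is generated by lines.** For `X` smooth projective of
dimension `n ≥ 2`, a closed `k`-immersion `i : X ⟶ ℙⁿ⁺¹_k` onto `V₊(F)` with `F` a quadratic form
satisfying the Jacobian criterion, over an algebraically closed field with `2 ≠ 0`, every `1`-cycle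
is rationally equivalent to an integral combination of lines of `X`.
[cite: TianZong2014, Thm. 1.7 (quadrics)] [cite: Fulton1998, Example 1.9.1] -/
theorem ProjectiveSpaceCells.chowOneGeneratedByLines_of_quadric {k : Type u} [Field k] [IsAlgClosed k]
    (h2 : (2 : k) ≠ 0) (n : ℕ) (hn : 2 ≤ n) {X : SchemeOver k}
    (F : MvPolynomial (Fin (n + 1 + 1)) k) (i : X ⟶ projectiveSpace (n + 1) k)
    (hX : IsSmoothProjective n X) (hF : F.IsHomogeneous 2)
    (hJ : IsNonsingularSystem k (fun _ : Fin 1 ↦ F)) (hi : IsClosedImmersion i.left)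
    (hV : Set.range i.left.base =
      ProjectiveSpectrum.zeroLocus (MvPolynomial.homogeneousSubmodule (Fin (n + 1 + 1)) k) {F}) :
    ChowOneGeneratedByLines (n + 1) i := by
  classical
  haveI : CompactSpace ↥X.left := IsSmoothProjective.compactSpace_holds hX
  haveI : IsIntegral X.left := IsSmoothProjective.isIntegral_holds hX
  -- normal form
  obtain ⟨τ, τ', hτ, hτ', hinv, hinv', hτli, hq⟩ :=
    ProjectiveSpaceCells.exists_linearSubst_splitForm (N := n + 1) h2 hF hJ
  let σ := ProjectiveSpace.substMapHom τ hτ τ' hτ' hinv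
  haveI : IsIso σ := ProjectiveSpaceCells.isIso_substMapHom τ hτ τ' hτ' hinv hinv'
  let i' : X.left ⟶ Proj (MvPolynomial.homogeneousSubmodule (Fin (n + 1 + 1)) k) := i.left
  haveI : IsClosedImmersion i' := hi
  let e := i' ≫ σ
  have hpre : σ.base ⁻¹' ProjectiveSpaceCells.stratum (k := k) 0 (n + 2) (by omega) =
      Set.range i'.base := by
    change σ.base ⁻¹' ProjectiveSpectrum.zeroLocus _ _ = Set.range i.left.base
    rw [ProjectiveSpaceCells.substMapHom_preimage_zeroLocus, hV]
    congr 1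
    rw [ProjectiveSpaceCells.coneGens, Set.image_union, Set.image_singleton]
    have hempty : {j : Fin (n + 1 + 1) | (j : ℕ) < 0} = ∅ := by ext j; simp
    rw [hempty, Set.image_empty, Set.image_empty, Set.empty_union, ← hq,
      ProjectiveSpaceCells.splitForm_eq_splitFormAt]
  have hrange : Set.range e.base = ProjectiveSpaceCells.stratum (k := k) 0 (n + 2) (by omega) := by
    rw [Scheme.Hom.comp_base, TopCat.coe_comp, Set.range_comp, ← hpre]
    exact Set.image_preimage_eq _ σ.homeomorph.surjective
  refine (chowOneGeneratedByLines_iff_forall_primeCycle (N := n + 1) (i := i)).mpr fun z hz ↦ ?_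
  have hrep : ProjectiveSpaceCells.LinesRep k e (primeCycle z) :=
    ProjectiveSpaceCells.linesRep_of_range_eq_stratum (N := n + 1) n (by omega) 0 (by omega)
      (by omega) e hrange (primeCycle z) (primeCycle_mem_cyclesOfDim (by simpa using hz))
  have hrep' : ProjectiveSpaceCells.LinesRep k i' (primeCycle z) :=
    ProjectiveSpaceCells.LinesRep.of_comp_substMapHom i' τ hτ τ' hτ' hinv hinv' hrep
  obtain ⟨r, ys, ws, hys, hrat⟩ := hrep'
  refine ⟨Finset.univ.image ys, fun y ↦ ∑ a ∈ Finset.univ.filter (fun a ↦ ys a = y), ws a,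
    fun y hy ↦ ?_, ?_⟩
  · obtain ⟨a, -, rfl⟩ := Finset.mem_image.mp hy
    exact hys a
  · have hsum : ∑ y ∈ Finset.univ.image ys, (∑ a ∈ Finset.univ.filter (fun a ↦ ys a = y), ws a) •
        primeCycle y = ∑ a, ws a • primeCycle (ys a) := by
      rw [← Finset.sum_fiberwise_of_maps_to (g := ys) (s := Finset.univ) (t := Finset.univ.image ys)
        (fun a _ ↦ Finset.mem_image_of_mem ys (Finset.mem_univ a))]
      refine Finset.sum_congr rfl fun y _ ↦ ?_
      rw [Finset.sum_smul]
      refine Finset.sum_congr rfl fun a ha ↦ ?_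
      rw [(Finset.mem_filter.mp ha).2]
    rw [hsum]
    exact hrat

end Fact

/-- **Tian–Zong Thm. 1.7 for quadric hypersurfaces.** The named fact
`TianZong2014_chowOne_generatedByLines` in the case `c = 1`, `d = 2`, `n ≥ 2`: `CH₁` of a smooth
quadric hypersurface `X ⊆ ℙⁿ⁺¹` over an algebraically closed field of characteristic zero is
generated by lines (split normal form + cellular decomposition, Fulton Example 1.9.1).
[cite: TianZong2014, Thm. 1.7 (quadrics)] [cite: Fulton1998, Example 1.9.1] -/
theorem TianZong2014_chowOne_generatedByLines_quadric ⦃k : Type u⦄ [Field k] [IsAlgClosed k]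
    [CharZero k] (n : ℕ) (hn : 2 ≤ n) (d : Fin 1 → ℕ) ⦃X : SchemeOver k⦄
    (F : Fin 1 → MvPolynomial (Fin (n + 1 + 1)) k) (i : X ⟶ projectiveSpace (n + 1) k)
    (hX : IsSmoothProjective n X)
    (hF : letI := MvPolynomial.gradedAlgebra (σ := Fin (n + 1 + 1)) (R := k)
      ∀ a, (F a).IsHomogeneous (d a))
    (hJ : IsNonsingularSystem k F) (hi : IsClosedImmersion i.left)
    (hV : letI := MvPolynomial.gradedAlgebra (σ := Fin (n + 1 + 1)) (R := k)
      Set.range i.left.base =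
        ProjectiveSpectrum.zeroLocus (MvPolynomial.homogeneousSubmodule (Fin (n + 1 + 1)) k)
          (Set.range F))
    (hd2 : d 0 = 2) : ChowOneGeneratedByLines (n + 1) i := by
  letI := MvPolynomial.gradedAlgebra (σ := Fin (n + 1 + 1)) (R := k)
  have hF2 : (F 0).IsHomogeneous 2 := by have h := hF 0; rwa [hd2] at h
  have hJ' : IsNonsingularSystem k (fun _ : Fin 1 ↦ F 0) := by
    have : (fun _ : Fin 1 ↦ F 0) = F := funext fun a ↦ by rw [Subsingleton.elim a 0]
    rwa [this]
  have hV' : Set.range i.left.base =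
      ProjectiveSpectrum.zeroLocus (MvPolynomial.homogeneousSubmodule (Fin (n + 1 + 1)) k) {F 0} := by
    rw [hV]
    congr 1
    ext f
    simp only [Set.mem_range, Set.mem_singleton_iff]
    exact ⟨fun ⟨a, ha⟩ ↦ by rw [← ha, Subsingleton.elim a 0], fun h ↦ ⟨0, h.symm⟩⟩
  exact ProjectiveSpaceCells.chowOneGeneratedByLines_of_quadric two_ne_zero n hn (F 0) i hX hF2 hJ' hi hV'

end Literature.AlgebraicGeometry.Motives
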